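import Summits.QuantumFields.BalabanUV.T4Continuum.Spine.NE1p.DressedRoot

/-!
# T⁴ programme, spine estimate NE1′ (node O3b/H2) — NON-VACUITY OF THE DRESSED ROW ROOT AND OF ITS END-B (decided toy)

Cell `pub-balaban`, sub-cell `t4`, BINDER-OWNERS row NE1′; owner lineage t4-ne1p-p1 (PROVER seat P1 «RG-trajectory comparison»),
generation 23; tree target `Summits/QuantumFields/BalabanUV/T4Continuum/Spine/NE1p/`; ADDITIVE — imports `Spine/NE1p/DressedRoot`
ONLY, modifies nothing.

CONTENTS.  `toyBooking K` / `toyTrajectory K` / `toyTower` — one observable-attached family per cutoff, born at scale `0`, felt at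
one cube of every scale, with POSITIVE booked size `(1/2)^k·(1/2)^K` at scale `k` (`toy_size_pos`) and one generation (the birth,
size `(1/2)^K`); `toyConstants` (`C = 1`, `A₀ = 1`, `ρ₁ = τ = 1/2`, `Λ = 2`, `N₀ = 1`, `ρ′ = 1/2`, `s̄⁰ = 1/2`, `m = 1/4`) and
`toyLeaves K : BookingLeaves toyConstants (toyBooking K) (toyTrajectory K)` — the END's binder family INHABITED AT EVERY CUTOFF WITH
ONE K-FREE SET OF CONSTANTS (rates `1/2`, no regeneration, action margin `0`, each family alone in its met component; births,
transport and regeneration hold outright, a fortiori under the dressed budget gate); `dressedStability_toyTower` — the root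
`DressedRoot.DressedStability toyTower` obtained THROUGH `DressedRoot.dressedStability_of_bookingLeaves` (END-B exercised end to
end: not vacuous, constants genuinely uniform).

HONEST FRAMING.  A decided toy over the booking vocabulary; NOTHING of Bałaban's densities is modelled or asserted; [folklore],
0 sorry, 0 citations.  Rung (B)+1 bookkeeping on one finite four-torus — NOT infinite volume, NOT a mass gap, NOT Clay, NOT summit
progress; spine PROVED 0∕9 unchanged.  HONEST DEPENDENCY: continuum YM on T⁴ ⇐ BetaPertH ∧ nine spine estimates (0/9 proved);
BetaPertH ⇐ (D1) ∧ (D4) ∧ CAP+tail; G-an2-4 gates asym, D1 and NE2/3/4.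
-/

noncomputable section

namespace Summit.QuantumFields.BalabanUV.T4Continuum.NE1p.DressedRoot

open Finset
open scoped BigOperators
open Literature.MathematicalPhysics.QuantumFieldTheory.Balaban1983to89
open Literature.MathematicalPhysics.QuantumFieldTheory.Balaban1983to89.T4TermFormat
open Literature.MathematicalPhysics.QuantumFieldTheory.Balaban1983to89.T4TermFormat.Booking
open Literature.MathematicalPhysics.QuantumFieldTheory.Balaban1983to89.T4GatedBooking
open Literature.MathematicalPhysics.QuantumFieldTheory.Balaban1983to89.T4TrajectoryComparison
open Summit.QuantumFields.BalabanUV.T4Continuum.T4TrajectoryDensityDressed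

/-! ## Non-vacuity: a one-family geometric tower meets the root THROUGH END-B with one set of constants -/

section Toy

/-- TOY BOOKING at cutoff `K` [decided toy]: one observable-attached family, born at scale `0`, felt at one cube of every scale,
with POSITIVE size `(1/2)^k·(1/2)^K` at scale `k` (non-degenerate).  Nothing of Bałaban's is modelled. [folklore] -/
def toyBooking (K : ℕ) : T4TermFormat.Booking where
  K := K
  Dom := Unit
  domScale := fun _ => 0
  treeLen := fun _ => 0
  treeLen_nonneg := fun _ => le_rfl
  balSize := fun _ => 0
  Birth := Unit
  births := {()}
  mem_births := fun b => by simp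
  birthScale := fun _ => 0
  birth_le := fun _ => Nat.zero_le K
  loc := fun _ => ()
  loc_scale := fun _ => rfl
  Cube := Fin (K + 1)
  cubes := Finset.univ
  mem_cubes := fun q => Finset.mem_univ q
  cubeScale := fun q => q.val
  cube_le := fun q => Nat.lt_succ_iff.mp q.isLt
  feltAt := fun _ => {()}
  felt_birth_le := fun _ _ _ => Nat.zero_le _
  size := fun _ k => (1 / 2 : ℝ) ^ k * (1 / 2 : ℝ) ^ K
  size_nonneg := fun _ _ => by positivity
  pair := fun _ _ _ => 0

/-- TOY TRAJECTORY [decided toy]: one generation (the birth, size `(1/2)^K`), re-linearised size = the booked size. [folklore] -/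
def toyTrajectory (K : ℕ) : Trajectory (toyBooking K) where
  lin := fun _ k' k => if k' = 0 then (1 / 2 : ℝ) ^ k * (1 / 2 : ℝ) ^ K else 0
  lin_nonneg := fun _ k' k => by split_ifs <;> positivity
  gen := fun _ k' => if k' = 0 then (1 / 2 : ℝ) ^ K else 0
  gen_nonneg := fun _ k' => by split_ifs <;> positivity
  size_le := fun b k _ _ => by
    show (1 / 2 : ℝ) ^ k * (1 / 2) ^ K ≤ ∑ k' ∈ Icc 0 k, (if k' = 0 then (1 / 2 : ℝ) ^ k * (1 / 2) ^ K else 0)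
    rw [Finset.sum_ite_eq' (Icc 0 k) 0 (fun _ => (1 / 2 : ℝ) ^ k * (1 / 2) ^ K)]
    simp

/-- TOY TOWER [decided toy]: the toy booking and trajectory at every cutoff (one run parameter). [folklore] -/
def toyTower : DressedTower Unit where
  B := fun _ K => toyBooking K
  K_eq := fun _ _ => rfl
  T := fun _ K => toyTrajectory K

/-- TOY CONSTANTS [decided toy]: `C = 1`, `A₀ = 1`, `ρ₁ = τ = 1/2`, `Λ = 2`, `N₀ = 1`, `ρ′ = 1/2` (`Λρ₁τ = 1/2`), `s̄⁰ = 1/2`,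
`m = 1/4` (`m·N₀A₀(1−ρ′)⁻¹ = 1/2 = 1 − s̄⁰`). [folklore] -/
def toyConstants : UniformConstants where
  C := 1
  A₀ := 1
  ρ₁ := 1 / 2
  τ := 1 / 2
  Λ := 2
  N₀ := 1
  ρ' := 1 / 2
  sbar := 1 / 2
  m := 1 / 4
  hC := zero_le_one
  hA₀ := zero_le_one
  hρ₁ := by norm_num
  hτ0 := by norm_num
  hτ1 := by norm_num
  hΛ := by norm_num
  hN₀ := zero_le_one
  hm := by norm_num
  hρ'1 := by norm_num
  hprod := by norm_num
  hsmall := by norm_num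

/-- TOY LEAVES [decided toy]: at every cutoff the leaf binders hold with `toyConstants` — rates `1/2`, no regeneration, action
margin `0`, each family alone in its component; births, transport and regeneration hold outright (a fortiori under the gate).
[folklore] -/
def toyLeaves (K : ℕ) : BookingLeaves toyConstants (toyBooking K) (toyTrajectory K) where
  ρ := fun _ => 1 / 2
  c := fun _ => 0
  s₀ := fun _ _ => 0
  S := fun _ b => {b}
  hρ := fun _ => by norm_num
  hc := fun _ => le_rfl
  hrate := fun _ _ => by
    show (1 / 2 : ℝ) + 1 * 0 ≤ 1 / 2
    norm_num
  hS := fun k b f _ => Nat.zero_le k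
  hcount := fun k b j _ => by
    show ((({b} : Finset Unit).filter fun _ => (0 : ℕ) = j).card : ℝ) ≤ 1 * 2 ^ (k - j)
    have h1 : ((({b} : Finset Unit).filter fun _ => (0 : ℕ) = j).card : ℝ) ≤ 1 := by
      exact_mod_cast (Finset.card_filter_le _ _).trans (Finset.card_singleton b).le
    exact h1.trans (by simpa using one_le_pow₀ (M₀ := ℝ) (a := 2) (n := k - j) (by norm_num))
  hs₀ := fun _ _ => by
    show (0 : ℝ) ≤ 1 / 2
    norm_num
  hbirth := fun b _ _ _ => by
    show (1 : ℝ) * (if (0 : ℕ) = 0 then (1 / 2 : ℝ) ^ K else 0) ≤ twoRate 1 (1 / 2) (1 / 2) K 0 0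
    simp [twoRate]
  htr := fun b k' k _ hk'k _ _ => by
    show (if k' = 0 then (1 / 2 : ℝ) ^ k * (1 / 2 : ℝ) ^ K else 0) ≤
      1 * stepProd (fun _ => (1 / 2 : ℝ)) k' k * (if k' = 0 then (1 / 2 : ℝ) ^ K else 0)
    by_cases h : k' = 0
    · subst h
      simp [stepProd_const]
    · simp [h]
  hreg := fun b k _ _ _ => by
    show (if k + 1 = 0 then (1 / 2 : ℝ) ^ K else 0) ≤ 0 * ((1 / 2 : ℝ) ^ k * (1 / 2 : ℝ) ^ K)
    simp

/-- **NON-VACUITY OF THE ROOT THROUGH END-B** [decided toy]: the toy tower has `DressedStability` — obtained from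
`dressedStability_of_bookingLeaves` with ONE `UniformConstants` serving every cutoff (END-B exercised end to end; its binder
family `BookingLeaves U` is inhabited at every `K` with the same `U`). [folklore] -/
theorem dressedStability_toyTower : DressedStability toyTower :=
  dressedStability_of_bookingLeaves toyConstants toyTower fun _ K => toyLeaves K

/-- The toy is non-degenerate: every booked size is positive at every cutoff and scale. [folklore] -/
theorem toy_size_pos (K k : ℕ) (b : (toyBooking K).Birth) : 0 < (toyBooking K).size b k := by
  show (0 : ℝ) < (1 / 2 : ℝ) ^ k * (1 / 2 : ℝ) ^ K
  positivity

end Toy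

end Summit.QuantumFields.BalabanUV.T4Continuum.NE1p.DressedRoot

end
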